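import Literature.Computability.Complexity.StackStrings
import Literature.Computability.Complexity.StackMachinesTM2
import HarnessLib

/-!
# Williams' Theorem 3.2, the machine `B`: the two linear-time plumbing stages

Companion of `Williams2014MachineB.lean` (R. Williams, *Nonuniform ACC circuit lower bounds*,
J. ACM 61 (2014), proof of Thm. 3.2, pp. 12–13), which assembles the machine `B` from three
string stages. This file BUILDS the two linear-time ones as structured stack programs
(`StackPrograms.Com`, compiled to Mathlib's `TM2` by `Com.outputsWithin_of_runs_equiv`,
`StackMachinesTM2.lean`) and proves their specifications:

* `MachineB.reassocProg`, **`exists_reassocMachine`** — stage 1 (`ReassocMachine`): on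
  `⟨⟨x, u⟩, z⟩` output `⟨⟨x, z₁⟩, guardLen |u| z₂⟩`, `(z₁, z₂) = boolUnpair z` (three runs of the
  pair decoder `Com.unpairW` of `StackStrings.lean`, a guard loop comparing `|z₂|` with `|u|`,
  and the re-assembly of the output by doubling/quadrupling loops), within `60 · |input| + 60`
  steps;
* `MachineB.dispatchProg`, **`exists_okDispatchMachine`** — stage 3 (`OkDispatchMachine`): on
  `⟨v, r⟩` output `okToken v r` (`1 ⟨out, r⟩` if `v = 1 out`, else `00`), within
  `30 · |input| + 30` steps — a rejected run of the generator is discarded at linear cost.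

Register files are written positionally (`MachineB.PR.file`, thirteen registers), in the
style of `AReg.file` (`StackArith.lean`).

## References

* R. Williams, *Nonuniform ACC circuit lower bounds*, J. ACM 61(1) (2014) 2:1–2:32, proof of
  Thm. 3.2 (pp. 12–13) [Williams2014].
* S. Arora, B. Barak, *Computational Complexity: A Modern Approach*, CUP 2009, §1.3 (machine
  constructions), §0.1 (pairing) [AroraBarak2009].
* T. Nipkow, G. Klein, *Concrete Semantics with Isabelle/HOL*, Springer 2014, Ch. 7–8.
-/

namespace Literature.Computability.Complexity

open _root_.Computability Turing

namespace MachineB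

/-! ### The register bank of the plumbing programs -/

/-- The thirteen registers of the plumbing programs: input, output, the two halves `A`, `B` of
the first decoding, the scratch `S`, the parts `X`, `U`, `YA`, `YW`, the collector `Cc`, the
decoder's mode and pending registers `M`, `P`, and the guard flag `G`. [folklore] -/
inductive PR where
  | inp | out | A | B | S | X | U | YA | YW | Cc | M | P | G
  deriving DecidableEq, Fintype, Repr

namespace PR

/-- A register file of the bank given register by register. [folklore] -/
def file (inp out A B S X U YA YW Cc M P G : List Bool) : Regs PR
  | .inp => inp
  | .out => out
  | .A => A
  | .B => B
  | .S => S
  | .X => X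
  | .U => U
  | .YA => YA
  | .YW => YW
  | .Cc => Cc
  | .M => M
  | .P => P
  | .G => G

section FileLemmas

variable {inp out A B S X U YA YW Cc M P G v : List Bool}

/-- Reading `inp`. [folklore] -/
@[simp] theorem file_inp : file inp out A B S X U YA YW Cc M P G .inp = inp := rfl

/-- Reading `out`. [folklore] -/
@[simp] theorem file_out : file inp out A B S X U YA YW Cc M P G .out = out := rfl

/-- Reading `A`. [folklore] -/
@[simp] theorem file_A : file inp out A B S X U YA YW Cc M P G .A = A := rfl

/-- Reading `B`. [folklore] -/
@[simp] theorem file_B : file inp out A B S X U YA YW Cc M P G .B = B := rfl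

/-- Reading `S`. [folklore] -/
@[simp] theorem file_S : file inp out A B S X U YA YW Cc M P G .S = S := rfl

/-- Reading `X`. [folklore] -/
@[simp] theorem file_X : file inp out A B S X U YA YW Cc M P G .X = X := rfl

/-- Reading `U`. [folklore] -/
@[simp] theorem file_U : file inp out A B S X U YA YW Cc M P G .U = U := rfl

/-- Reading `YA`. [folklore] -/
@[simp] theorem file_YA : file inp out A B S X U YA YW Cc M P G .YA = YA := rfl

/-- Reading `YW`. [folklore] -/
@[simp] theorem file_YW : file inp out A B S X U YA YW Cc M P G .YW = YW := rfl

/-- Reading `Cc`. [folklore] -/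
@[simp] theorem file_Cc : file inp out A B S X U YA YW Cc M P G .Cc = Cc := rfl

/-- Reading `M`. [folklore] -/
@[simp] theorem file_M : file inp out A B S X U YA YW Cc M P G .M = M := rfl

/-- Reading `P`. [folklore] -/
@[simp] theorem file_P : file inp out A B S X U YA YW Cc M P G .P = P := rfl

/-- Reading `G`. [folklore] -/
@[simp] theorem file_G : file inp out A B S X U YA YW Cc M P G .G = G := rfl

/-- Updating `inp`. [folklore] -/
@[simp] theorem update_file_inp : Function.update (file inp out A B S X U YA YW Cc M P G) .inp v = file v out A B S X U YA YW Cc M P G := by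
  funext i; cases i <;> rfl

/-- Updating `out`. [folklore] -/
@[simp] theorem update_file_out : Function.update (file inp out A B S X U YA YW Cc M P G) .out v = file inp v A B S X U YA YW Cc M P G := by
  funext i; cases i <;> rfl

/-- Updating `A`. [folklore] -/
@[simp] theorem update_file_A : Function.update (file inp out A B S X U YA YW Cc M P G) .A v = file inp out v B S X U YA YW Cc M P G := by
  funext i; cases i <;> rfl

/-- Updating `B`. [folklore] -/
@[simp] theorem update_file_B : Function.update (file inp out A B S X U YA YW Cc M P G) .B v = file inp out A v S X U YA YW Cc M P G := by
  funext i; cases i <;> rfl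

/-- Updating `S`. [folklore] -/
@[simp] theorem update_file_S : Function.update (file inp out A B S X U YA YW Cc M P G) .S v = file inp out A B v X U YA YW Cc M P G := by
  funext i; cases i <;> rfl

/-- Updating `X`. [folklore] -/
@[simp] theorem update_file_X : Function.update (file inp out A B S X U YA YW Cc M P G) .X v = file inp out A B S v U YA YW Cc M P G := by
  funext i; cases i <;> rfl

/-- Updating `U`. [folklore] -/
@[simp] theorem update_file_U : Function.update (file inp out A B S X U YA YW Cc M P G) .U v = file inp out A B S X v YA YW Cc M P G := by
  funext i; cases i <;> rfl

/-- Updating `YA`. [folklore] -/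
@[simp] theorem update_file_YA : Function.update (file inp out A B S X U YA YW Cc M P G) .YA v = file inp out A B S X U v YW Cc M P G := by
  funext i; cases i <;> rfl

/-- Updating `YW`. [folklore] -/
@[simp] theorem update_file_YW : Function.update (file inp out A B S X U YA YW Cc M P G) .YW v = file inp out A B S X U YA v Cc M P G := by
  funext i; cases i <;> rfl

/-- Updating `Cc`. [folklore] -/
@[simp] theorem update_file_Cc : Function.update (file inp out A B S X U YA YW Cc M P G) .Cc v = file inp out A B S X U YA YW v M P G := by
  funext i; cases i <;> rfl

/-- Updating `M`. [folklore] -/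
@[simp] theorem update_file_M : Function.update (file inp out A B S X U YA YW Cc M P G) .M v = file inp out A B S X U YA YW Cc v P G := by
  funext i; cases i <;> rfl

/-- Updating `P`. [folklore] -/
@[simp] theorem update_file_P : Function.update (file inp out A B S X U YA YW Cc M P G) .P v = file inp out A B S X U YA YW Cc M v G := by
  funext i; cases i <;> rfl

/-- Updating `G`. [folklore] -/
@[simp] theorem update_file_G : Function.update (file inp out A B S X U YA YW Cc M P G) .G v = file inp out A B S X U YA YW Cc M P v := by
  funext i; cases i <;> rfl

end FileLemmas

/-- `Regs.init .inp w` as a file. [folklore] -/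
theorem init_inp_eq_file (w : List Bool) :
    Regs.init PR.inp w = file w [] [] [] [] [] [] [] [] [] [] [] [] := by
  funext r; cases r <;> rfl

/-- `Regs.init .out w` as a file. [folklore] -/
theorem init_out_eq_file (w : List Bool) :
    Regs.init PR.out w = file [] w [] [] [] [] [] [] [] [] [] [] [] := by
  funext r; cases r <;> rfl

end PR

/-! ### Small loops -/

open PR Com

/-- `setFlagG`: set the guard flag `G` (which holds a flag). [folklore] -/
def setFlagG : Com PR := pop .G (push .G true) (push .G true) (push .G true)

/-- `setFlagG` sets the flag. [folklore] -/
theorem runs_setFlagG (inp out A B S X U YA YW Cc M P : List Bool) (c : Bool) :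
    Runs setFlagG (file inp out A B S X U YA YW Cc M P (flag c))
      (file inp out A B S X U YA YW Cc M P (flag true)) 3 := by
  cases c
  · exact (Runs.pop_nil _ _ (by rfl) (Runs.push _ _ _)).of_eq (by simp) le_rfl
  · have h : Runs (Com.push PR.G true) (file inp out A B S X U YA YW Cc M P [])
        (file inp out A B S X U YA YW Cc M P [true]) 1 := Runs.push' (by simp)
    exact Runs.pop_true' _ _ (R := file inp out A B S X U YA YW Cc M P (flag true)) (w := [])
      rfl (by simp) h

/-- `dblLoop`: pour `YA` onto `out`, doubling every bit. [folklore] -/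
def dblLoop : Com PR :=
  loop .YA (push .out true ;; push .out true) (push .out false ;; push .out false)

/-- Effect of `dblLoop`: `out := (reverse l).flatMap (b ↦ bb) ++ out`, in `4|l| + 1` steps.
[folklore] -/
theorem runs_dblLoop (l : List Bool) (inp out A B S X U YW Cc M P G : List Bool) :
    Runs dblLoop (file inp out A B S X U l YW Cc M P G)
      (file inp ((l.reverse.flatMap fun b => [b, b]) ++ out) A B S X U [] YW Cc M P G)
      (4 * l.length + 1) := by
  induction l generalizing out with
  | nil => exact (Runs.loop_nil _ _ (by rfl)).of_eq (by simp) (by simp)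
  | cons b l ih =>
    have hbody : ∀ b : Bool, Runs (push PR.out b ;; push PR.out b) (file inp out A B S X U l YW Cc M P G)
        (file inp (b :: b :: out) A B S X U l YW Cc M P G) (1 + 1) := fun b =>
      ((Runs.push _ _ _).seq (Runs.push _ _ _)).of_eq (by simp) le_rfl
    have hfin : (l.reverse.flatMap fun b => [b, b]) ++ (b :: b :: out) =
        ((b :: l).reverse.flatMap fun b => [b, b]) ++ out := by
      simp [List.flatMap_append]
    cases b
    · exact (Runs.loop_false' (by rfl) (by simp) (hbody false) (ih (false :: false :: out))).of_eq
        (by rw [hfin]) (by simp; omega)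
    · exact (Runs.loop_true' (by rfl) (by simp) (hbody true) (ih (true :: true :: out))).of_eq
        (by rw [hfin]) (by simp; omega)

/-- `quadLoop`: pour `X` onto `out`, quadrupling every bit. [folklore] -/
def quadLoop : Com PR :=
  loop .X (push .out true ;; push .out true ;; push .out true ;; push .out true)
    (push .out false ;; push .out false ;; push .out false ;; push .out false)

/-- Effect of `quadLoop`: `out := (reverse l).flatMap (b ↦ bbbb) ++ out`, in `6|l| + 1` steps.
[folklore] -/
theorem runs_quadLoop (l : List Bool) (inp out A B S U YA YW Cc M P G : List Bool) :
    Runs quadLoop (file inp out A B S l U YA YW Cc M P G)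
      (file inp ((l.reverse.flatMap fun b => [b, b, b, b]) ++ out) A B S [] U YA YW Cc M P G)
      (6 * l.length + 1) := by
  induction l generalizing out with
  | nil => exact (Runs.loop_nil _ _ (by rfl)).of_eq (by simp) (by simp)
  | cons b l ih =>
    have hbody : ∀ b : Bool,
        Runs (push PR.out b ;; push PR.out b ;; push PR.out b ;; push PR.out b)
          (file inp out A B S l U YA YW Cc M P G)
          (file inp (b :: b :: b :: b :: out) A B S l U YA YW Cc M P G) (1 + (1 + (1 + 1))) := fun b =>
      ((Runs.push _ _ _).seq ((Runs.push _ _ _).seq ((Runs.push _ _ _).seq (Runs.push _ _ _)))).of_eq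
        (by simp) le_rfl
    have hfin : (l.reverse.flatMap fun b => [b, b, b, b]) ++ (b :: b :: b :: b :: out) =
        ((b :: l).reverse.flatMap fun b => [b, b, b, b]) ++ out := by
      simp [List.flatMap_append]
    cases b
    · exact (Runs.loop_false' (by rfl) (by simp) (hbody false)
        (ih (false :: false :: false :: false :: out))).of_eq (by rw [hfin]) (by simp; omega)
    · exact (Runs.loop_true' (by rfl) (by simp) (hbody true)
        (ih (true :: true :: true :: true :: out))).of_eq (by rw [hfin]) (by simp; omega)

/-- The body of the guard loop on the bit `b` of `YW`: pop one symbol of the yardstick `U`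
(setting the flag `G` if it is exhausted) and collect `b` on `Cc`. [folklore] -/
def guardBody (b : Bool) : Com PR := pop .U (push .Cc b) (push .Cc b) (push .Cc b ;; setFlagG)

/-- `guardLoop`: move `YW` onto `Cc` (reversing it) while consuming the yardstick `U` symbol for
symbol; the flag `G` records that `YW` was longer than `U`. [folklore] -/
def guardLoop : Com PR := loop .YW (guardBody true) (guardBody false)

/-- Effect of the guard body when the yardstick is exhausted: collect `b`, set the flag.
[folklore] -/
theorem runs_guardBody_nil (b : Bool) (cc : List Bool) (c : Bool)
    (inp out A B S X YA YW M P : List Bool) :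
    Runs (guardBody b) (file inp out A B S X [] YA YW cc M P (flag c))
      (file inp out A B S X [] YA YW (b :: cc) M P (flag true)) 6 := by
  have h1 : Runs (push PR.Cc b) (file inp out A B S X [] YA YW cc M P (flag c))
      (file inp out A B S X [] YA YW (b :: cc) M P (flag c)) 1 := Runs.push' (by simp)
  have h := h1.seq (runs_setFlagG inp out A B S X [] YA YW (b :: cc) M P c)
  exact (Runs.pop_nil _ _ (by rfl) h).of_eq rfl (by omega)

/-- Effect of the guard body when the yardstick is not exhausted: pop it, collect `b`.
[folklore] -/
theorem runs_guardBody_cons (b d : Bool) (u cc G : List Bool)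
    (inp out A B S X YA YW M P : List Bool) :
    Runs (guardBody b) (file inp out A B S X (d :: u) YA YW cc M P G)
      (file inp out A B S X u YA YW (b :: cc) M P G) 3 := by
  have h1 : Runs (push PR.Cc b) (file inp out A B S X u YA YW cc M P G)
      (file inp out A B S X u YA YW (b :: cc) M P G) 1 := Runs.push' (by simp)
  cases d
  · exact Runs.pop_false' _ _ (R := file inp out A B S X (false :: u) YA YW cc M P G) (w := u)
      rfl (by simp) h1
  · exact Runs.pop_true' _ _ (R := file inp out A B S X (true :: u) YA YW cc M P G) (w := u)
      rfl (by simp) h1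

/-- **Effect of the guard loop**: `U := U.drop |l|`, `YW := ε`, `Cc := reverse l ++ Cc`, and the
flag records `|U| < |l|`, in `8|l| + 1` steps. [folklore] -/
theorem runs_guardLoop (l u cc : List Bool) (c : Bool) (inp out A B S X YA M P : List Bool) :
    Runs guardLoop (file inp out A B S X u YA l cc M P (flag c))
      (file inp out A B S X (u.drop l.length) YA [] (l.reverse ++ cc) M P
        (flag (c || decide (u.length < l.length)))) (8 * l.length + 1) := by
  induction l generalizing u cc c with
  | nil => exact (Runs.loop_nil _ _ (by rfl)).of_eq (by simp) (by simp)
  | cons b l ih =>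
    rcases u with _ | ⟨d, u⟩
    · -- yardstick exhausted
      have hflag : (true || decide (([] : List Bool).length < l.length)) =
          (c || decide (([] : List Bool).length < (b :: l).length)) := by simp
      have hfin : file inp out A B S X (([] : List Bool).drop l.length) YA [] (l.reverse ++ (b :: cc)) M P
            (flag (true || decide (([] : List Bool).length < l.length))) =
          file inp out A B S X (([] : List Bool).drop (b :: l).length) YA [] ((b :: l).reverse ++ cc) M P
            (flag (c || decide (([] : List Bool).length < (b :: l).length))) := by
        rw [hflag]; simp
      cases b
      · exact (Runs.loop_false' (by rfl) (by simp) (runs_guardBody_nil false cc c _ _ _ _ _ _ _ _ _ _)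
          (ih [] (false :: cc) true)).of_eq hfin (by simp; omega)
      · exact (Runs.loop_true' (by rfl) (by simp) (runs_guardBody_nil true cc c _ _ _ _ _ _ _ _ _ _)
          (ih [] (true :: cc) true)).of_eq hfin (by simp; omega)
    · -- yardstick popped
      have hflag : (c || decide (u.length < l.length)) =
          (c || decide ((d :: u).length < (b :: l).length)) := by simp
      have hfin : file inp out A B S X (u.drop l.length) YA [] (l.reverse ++ (b :: cc)) M P
            (flag (c || decide (u.length < l.length))) =
          file inp out A B S X ((d :: u).drop (b :: l).length) YA [] ((b :: l).reverse ++ cc) M P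
            (flag (c || decide ((d :: u).length < (b :: l).length))) := by
        rw [hflag]; simp
      cases b
      · exact (Runs.loop_false' (by rfl) (by simp)
          (runs_guardBody_cons false d u cc (flag c) _ _ _ _ _ _ _ _ _ _)
          (ih u (false :: cc) c)).of_eq hfin (by simp; omega)
      · exact (Runs.loop_true' (by rfl) (by simp)
          (runs_guardBody_cons true d u cc (flag c) _ _ _ _ _ _ _ _ _ _)
          (ih u (true :: cc) c)).of_eq hfin (by simp; omega)

/-! ### The shape of the output words -/

/-- `⟨⟨x, y⟩, g⟩` spelled out: quadrupled `x`, `0011`, doubled `y`, `01`, `g`. [folklore] -/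
theorem boolPair_boolPair_eq (x y g : List Bool) :
    boolPair (boolPair x y) g =
      (x.flatMap fun b => [b, b, b, b]) ++ false :: false :: true :: true ::
        ((y.flatMap fun b => [b, b]) ++ false :: true :: g) := by
  induction x with
  | nil => simp [boolPair]
  | cons b x ih =>
    simp only [boolPair, List.flatMap_cons, List.append_assoc, List.cons_append, List.nil_append,
      List.flatMap_append] at ih ⊢
    simpa using ih

/-- `⟨a, b⟩` spelled out: doubled `a`, `01`, `b`. [folklore] -/
theorem boolPair_eq_flatMap (a b : List Bool) :
    boolPair a b = (a.flatMap fun c => [c, c]) ++ false :: true :: b := by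
  simp [boolPair]

/-! ### Stage 1: re-association with a length guard -/

/-- **The program of stage 1.** Decode `⟨⟨x, u⟩, z⟩` (three runs of the pair decoder), run the
guard loop comparing `|z₂|` with `|u|`, drop `z₂` if it is longer, and write
`⟨⟨x, z₁⟩, z₂'⟩` on the output register. [folklore] -/
def reassocProg : Com PR :=
  unpairW .inp .A .B .M .P ;; clear .M ;;
  pour .B .S ;; unpairW .S .YA .YW .M .P ;; clear .M ;;
  pour .A .S ;; unpairW .S .X .U .M .P ;; clear .M ;;
  guardLoop ;; clear .U ;;
  pop .G (clear .Cc) (clear .Cc) skip ;;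
  pour .Cc .YW ;; pour .YW .out ;; push .out true ;; push .out false ;;
  dblLoop ;; push .out true ;; push .out true ;; push .out false ;; push .out false ;;
  quadLoop

/-- **Semantics of stage 1**: from `⟨⟨x, u⟩, z⟩` on the input register to
`⟨⟨x, z₁⟩, z₂'⟩` on the output register (`(z₁, z₂) = boolUnpair z`, `z₂' = z₂` if `|z₂| ≤ |u|`
and `ε` otherwise), all other registers empty, within `60 |input| + 60` steps. [folklore] -/
theorem runs_reassocProg (x u z : List Bool) :
    Runs reassocProg (file (boolPair (boolPair x u) z) [] [] [] [] [] [] [] [] [] [] [] [])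
      (file [] (boolPair (boolPair x (boolUnpair z).1)
        (if (boolUnpair z).2.length ≤ u.length then (boolUnpair z).2 else [])) [] [] [] [] [] [] [] [] [] [] [])
      (60 * (boolPair (boolPair x u) z).length + 60) := by
  obtain ⟨yA, hyA⟩ : ∃ yA, yA = (boolUnpair z).1 := ⟨_, rfl⟩
  obtain ⟨yW, hyW⟩ : ∃ yW, yW = (boolUnpair z).2 := ⟨_, rfl⟩
  have hparts : 2 * yA.length + yW.length ≤ z.length := by
    rw [hyA, hyW]; exact length_boolUnpair_parts_le z
  obtain ⟨g, hg⟩ : ∃ g : List Bool, g = if yW.length ≤ u.length then yW else [] := ⟨_, rfl⟩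
  have hglen : g.length ≤ yW.length := by rw [hg]; split_ifs <;> simp
  rw [← hyA, ← hyW, ← hg]
  -- the cost, summed along the program (computed first, in a small context)
  have hcost : (boolPair (boolPair x u) z).length * 7 + 7 + (3 + (3 * z.length + 1 + (z.length * 7 + 7 + (3 + (3 * (boolPair x u).length + 1 + ((boolPair x u).length * 7 + 7 + (3 + (8 * yW.length + 1 + (2 * u.length + 1 + (2 * yW.length + 3 + (3 * g.length + 1 + (3 * g.length + 1 + (1 + (1 + (4 * yA.length + 1 + (1 + (1 + (1 + (1 + (6 * x.length + 1)))))))))))))))))))) ≤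
      60 * (boolPair (boolPair x u) z).length + 60 := by
    simp only [length_boolPair]
    linarith
  -- step 1–2: decode the outer pair
  have h1 : Runs (unpairW .inp .A .B .M .P)
      (file (boolPair (boolPair x u) z) [] [] [] [] [] [] [] [] [] [] [] [])
      (file [] [] (boolPair x u).reverse z.reverse [] [] [] [] [] [] [true] [] [])
      ((boolPair (boolPair x u) z).length * 7 + 7) :=
    (runs_unpairW (by decide) _ rfl rfl).of_eq (by simp [wellPaired_boolPair]) (by simp)
  have h2 : Runs (clear .M) (file [] [] (boolPair x u).reverse z.reverse [] [] [] [] [] [] [true] [] [])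
      (file [] [] (boolPair x u).reverse z.reverse [] [] [] [] [] [] [] [] []) 3 :=
    (runs_clear _ _).of_eq (by simp) (by simp)
  -- step 3–5: decode `z`
  have h3 : Runs (pour .B .S) (file [] [] (boolPair x u).reverse z.reverse [] [] [] [] [] [] [] [] [])
      (file [] [] (boolPair x u).reverse [] z [] [] [] [] [] [] [] []) (3 * z.length + 1) :=
    (runs_pour (by decide) _).of_eq (by simp) (by simp)
  have h4 : Runs (unpairW .S .YA .YW .M .P) (file [] [] (boolPair x u).reverse [] z [] [] [] [] [] [] [] [])
      (file [] [] (boolPair x u).reverse [] [] [] [] yA.reverse yW.reverse [] (flag (wellPaired z)) [] [])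
      (z.length * 7 + 7) :=
    (runs_unpairW (by decide) _ rfl rfl).of_eq (by simp [hyA, hyW]) (by simp)
  have h5 : Runs (clear .M)
      (file [] [] (boolPair x u).reverse [] [] [] [] yA.reverse yW.reverse [] (flag (wellPaired z)) [] [])
      (file [] [] (boolPair x u).reverse [] [] [] [] yA.reverse yW.reverse [] [] [] []) 3 :=
    (runs_clear _ _).of_eq (by simp) (by cases wellPaired z <;> simp)
  -- step 6–8: decode `⟨x, u⟩`
  have h6 : Runs (pour .A .S) (file [] [] (boolPair x u).reverse [] [] [] [] yA.reverse yW.reverse [] [] [] [])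
      (file [] [] [] [] (boolPair x u) [] [] yA.reverse yW.reverse [] [] [] []) (3 * (boolPair x u).length + 1) :=
    (runs_pour (by decide) _).of_eq (by simp) (by simp)
  have h7 : Runs (unpairW .S .X .U .M .P) (file [] [] [] [] (boolPair x u) [] [] yA.reverse yW.reverse [] [] [] [])
      (file [] [] [] [] [] x.reverse u.reverse yA.reverse yW.reverse [] [true] [] [])
      ((boolPair x u).length * 7 + 7) :=
    (runs_unpairW (by decide) _ rfl rfl).of_eq (by simp [wellPaired_boolPair]) (by simp)
  have h8 : Runs (clear .M) (file [] [] [] [] [] x.reverse u.reverse yA.reverse yW.reverse [] [true] [] [])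
      (file [] [] [] [] [] x.reverse u.reverse yA.reverse yW.reverse [] [] [] []) 3 :=
    (runs_clear _ _).of_eq (by simp) (by simp)
  -- step 9–11: the guard
  have h9 : Runs guardLoop (file [] [] [] [] [] x.reverse u.reverse yA.reverse yW.reverse [] [] [] [])
      (file [] [] [] [] [] x.reverse (u.reverse.drop yW.length) yA.reverse [] yW [] []
        (flag (decide (u.length < yW.length)))) (8 * yW.length + 1) :=
    (runs_guardLoop yW.reverse u.reverse [] false [] [] [] [] [] x.reverse yA.reverse [] []).of_eq
      (by simp) (by simp)
  have h10 : Runs (clear .U)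
      (file [] [] [] [] [] x.reverse (u.reverse.drop yW.length) yA.reverse [] yW [] []
        (flag (decide (u.length < yW.length))))
      (file [] [] [] [] [] x.reverse [] yA.reverse [] yW [] [] (flag (decide (u.length < yW.length))))
      (2 * u.length + 1) :=
    (runs_clear _ _).of_eq (by simp) (by simp)
  have h11 : Runs (pop .G (clear .Cc) (clear .Cc) skip)
      (file [] [] [] [] [] x.reverse [] yA.reverse [] yW [] [] (flag (decide (u.length < yW.length))))
      (file [] [] [] [] [] x.reverse [] yA.reverse [] g [] [] []) (2 * yW.length + 3) := by
    by_cases hlt : u.length < yW.length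
    · have hg' : g = [] := by rw [hg, if_neg (not_le.mpr hlt)]
      rw [hg']
      have hc : Runs (clear .Cc) (file [] [] [] [] [] x.reverse [] yA.reverse [] yW [] [] [])
          (file [] [] [] [] [] x.reverse [] yA.reverse [] [] [] [] []) (2 * yW.length + 1) :=
        (runs_clear _ _).of_eq (by simp) (by simp)
      exact Runs.pop_true' _ _
        (R := file [] [] [] [] [] x.reverse [] yA.reverse [] yW [] [] (flag (decide (u.length < yW.length))))
        (w := []) (by simp [hlt]) (by simp) hc
    · have hg' : g = yW := by rw [hg, if_pos (not_lt.mp hlt)]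
      rw [hg']
      exact (Runs.pop_nil _ _ (by simp [hlt]) (Runs.skip _)).of_eq (by simp [hlt]) (by simp)
  -- step 12–14: write `01 g`
  have h12 : Runs (pour .Cc .YW) (file [] [] [] [] [] x.reverse [] yA.reverse [] g [] [] [])
      (file [] [] [] [] [] x.reverse [] yA.reverse g.reverse [] [] [] []) (3 * g.length + 1) :=
    (runs_pour (by decide) _).of_eq (by simp) (by simp)
  have h13 : Runs (pour .YW .out) (file [] [] [] [] [] x.reverse [] yA.reverse g.reverse [] [] [] [])
      (file [] g [] [] [] x.reverse [] yA.reverse [] [] [] [] []) (3 * g.length + 1) :=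
    (runs_pour (by decide) _).of_eq (by simp) (by simp)
  have h14 : Runs (push .out true) (file [] g [] [] [] x.reverse [] yA.reverse [] [] [] [] [])
      (file [] (true :: g) [] [] [] x.reverse [] yA.reverse [] [] [] [] []) 1 := Runs.push' (by simp)
  have h15 : Runs (push .out false) (file [] (true :: g) [] [] [] x.reverse [] yA.reverse [] [] [] [] [])
      (file [] (false :: true :: g) [] [] [] x.reverse [] yA.reverse [] [] [] [] []) 1 := Runs.push' (by simp)
  -- step 15–16: doubled `z₁`, then `0011`
  have h16 : Runs dblLoop (file [] (false :: true :: g) [] [] [] x.reverse [] yA.reverse [] [] [] [] [])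
      (file [] ((yA.flatMap fun b => [b, b]) ++ false :: true :: g) [] [] [] x.reverse [] [] [] [] [] [] [])
      (4 * yA.length + 1) :=
    (runs_dblLoop yA.reverse [] (false :: true :: g) [] [] [] x.reverse [] [] [] [] [] []).of_eq
      (by simp) (by simp)
  have h17 : Runs (push .out true)
      (file [] ((yA.flatMap fun b => [b, b]) ++ false :: true :: g) [] [] [] x.reverse [] [] [] [] [] [] [])
      (file [] (true :: ((yA.flatMap fun b => [b, b]) ++ false :: true :: g)) [] [] [] x.reverse [] [] [] [] [] [] [])
      1 := Runs.push' (by simp)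
  have h18 : Runs (push .out true)
      (file [] (true :: ((yA.flatMap fun b => [b, b]) ++ false :: true :: g)) [] [] [] x.reverse [] [] [] [] [] [] [])
      (file [] (true :: true :: ((yA.flatMap fun b => [b, b]) ++ false :: true :: g)) [] [] [] x.reverse [] [] [] [] [] [] [])
      1 := Runs.push' (by simp)
  have h19 : Runs (push .out false)
      (file [] (true :: true :: ((yA.flatMap fun b => [b, b]) ++ false :: true :: g)) [] [] [] x.reverse [] [] [] [] [] [] [])
      (file [] (false :: true :: true :: ((yA.flatMap fun b => [b, b]) ++ false :: true :: g)) [] [] [] x.reverse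
        [] [] [] [] [] [] []) 1 := Runs.push' (by simp)
  have h20 : Runs (push .out false)
      (file [] (false :: true :: true :: ((yA.flatMap fun b => [b, b]) ++ false :: true :: g)) [] [] [] x.reverse
        [] [] [] [] [] [] [])
      (file [] (false :: false :: true :: true :: ((yA.flatMap fun b => [b, b]) ++ false :: true :: g)) [] [] []
        x.reverse [] [] [] [] [] [] []) 1 := Runs.push' (by simp)
  -- step 17: quadrupled `x`
  have h21 : Runs quadLoop
      (file [] (false :: false :: true :: true :: ((yA.flatMap fun b => [b, b]) ++ false :: true :: g)) [] [] []
        x.reverse [] [] [] [] [] [] [])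
      (file [] ((x.flatMap fun b => [b, b, b, b]) ++ false :: false :: true :: true ::
        ((yA.flatMap fun b => [b, b]) ++ false :: true :: g)) [] [] [] [] [] [] [] [] [] [] [])
      (6 * x.length + 1) :=
    (runs_quadLoop x.reverse [] _ [] [] [] [] [] [] [] [] [] []).of_eq (by simp) (by simp)
  have hall := h1.seq (h2.seq (h3.seq (h4.seq (h5.seq (h6.seq (h7.seq (h8.seq (h9.seq (h10.seq
    (h11.seq (h12.seq (h13.seq (h14.seq (h15.seq (h16.seq (h17.seq (h18.seq (h19.seq (h20.seq
      h21)))))))))))))))))))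
  exact hall.of_eq (by rw [boolPair_boolPair_eq]) hcost

/-- **Stage 1 as a `TM2` machine**: on `⟨⟨x, u⟩, z⟩` it outputs `⟨⟨x, z₁⟩, z₂'⟩` within
`61 |input| + 61` steps (the form `ReassocMachine P 61` of `Williams2014MachineB.lean`).
[cite: AroraBarak2009, §1.3 (machine constructions)] -/
theorem exists_reassocMachine :
    ∃ P : TM2ComputableAux Bool Bool, ∀ x u z : List Bool,
      P.OutputsWithin (boolPair (boolPair x u) z)
        (boolPair (boolPair x (boolUnpair z).1)
          (if (boolUnpair z).2.length ≤ u.length then (boolUnpair z).2 else []))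
        (61 * (boolPair (boolPair x u) z).length + 61) := by
  refine ⟨(compile (reassocProg.map (Fintype.equivFin PR))).toAux (Fintype.equivFin PR .inp)
    (Fintype.equivFin PR .out), fun x u z => ?_⟩
  have h := runs_reassocProg x u z
  rw [← init_inp_eq_file, ← init_out_eq_file] at h
  exact (Com.outputsWithin_of_runs_equiv (Fintype.equivFin PR) (Or.inl h)).mono (by omega)

/-! ### Stage 3: dispatch on the generator's flag -/

/-- **The program of stage 3.** Decode `⟨v, r⟩`; if `v = 1 out` write `1 ⟨out, r⟩`, otherwise
discard everything and write `00`. [folklore] -/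
def dispatchProg : Com PR :=
  unpairW .inp .A .B .M .P ;; clear .M ;; pour .A .S ;;
  pop .S
    (pour .B .out ;; push .out true ;; push .out false ;; pour .S .YA ;; dblLoop ;; push .out true)
    (clear .S ;; clear .B ;; push .out false ;; push .out false)
    (clear .B ;; push .out false ;; push .out false)

/-- The common prefix of stage 3 (in continuation form): `A := reverse v` poured to `S := v`,
`B := reverse r`, then the continuation `c`. [folklore] -/
theorem runs_dispatch_prefix (v r : List Bool) {c : Com PR} {R' : Regs PR} {B₀ : ℕ}
    (hc : Runs c (file [] [] [] r.reverse v [] [] [] [] [] [] [] []) R' B₀) :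
    Runs (unpairW .inp .A .B .M .P ;; clear .M ;; pour .A .S ;; c)
      (file (boolPair v r) [] [] [] [] [] [] [] [] [] [] [] []) R'
      ((boolPair v r).length * 7 + 7 + (3 + (3 * v.length + 1 + B₀))) := by
  have h1 : Runs (unpairW .inp .A .B .M .P) (file (boolPair v r) [] [] [] [] [] [] [] [] [] [] [] [])
      (file [] [] v.reverse r.reverse [] [] [] [] [] [] [true] [] []) ((boolPair v r).length * 7 + 7) :=
    (runs_unpairW (by decide) _ rfl rfl).of_eq (by simp [wellPaired_boolPair]) (by simp)
  have h2 : Runs (clear .M) (file [] [] v.reverse r.reverse [] [] [] [] [] [] [true] [] [])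
      (file [] [] v.reverse r.reverse [] [] [] [] [] [] [] [] []) 3 :=
    (runs_clear _ _).of_eq (by simp) (by simp)
  have h3 : Runs (pour .A .S) (file [] [] v.reverse r.reverse [] [] [] [] [] [] [] [] [])
      (file [] [] [] r.reverse v [] [] [] [] [] [] [] []) (3 * v.length + 1) :=
    (runs_pour (by decide) _).of_eq (by simp) (by simp)
  exact h1.seq (h2.seq (h3.seq hc))

/-- **Semantics of stage 3 on an accepting flag**: `⟨1 out, r⟩ ↦ 1 ⟨out, r⟩` within
`30 |input| + 30` steps. [folklore] -/
theorem runs_dispatchProg_true (out r : List Bool) :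
    Runs dispatchProg (file (boolPair (true :: out) r) [] [] [] [] [] [] [] [] [] [] [] [])
      (file [] (true :: boolPair out r) [] [] [] [] [] [] [] [] [] [] [])
      (30 * (boolPair (true :: out) r).length + 30) := by
  have h1 : Runs (pour .B .out) (file [] [] [] r.reverse out [] [] [] [] [] [] [] [])
      (file [] r [] [] out [] [] [] [] [] [] [] []) (3 * r.length + 1) :=
    (runs_pour (by decide) _).of_eq (by simp) (by simp)
  have h2 : Runs (push .out true) (file [] r [] [] out [] [] [] [] [] [] [] [])
      (file [] (true :: r) [] [] out [] [] [] [] [] [] [] []) 1 := Runs.push' (by simp)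
  have h3 : Runs (push .out false) (file [] (true :: r) [] [] out [] [] [] [] [] [] [] [])
      (file [] (false :: true :: r) [] [] out [] [] [] [] [] [] [] []) 1 := Runs.push' (by simp)
  have h4 : Runs (pour .S .YA) (file [] (false :: true :: r) [] [] out [] [] [] [] [] [] [] [])
      (file [] (false :: true :: r) [] [] [] [] [] out.reverse [] [] [] [] []) (3 * out.length + 1) :=
    (runs_pour (by decide) _).of_eq (by simp) (by simp)
  have h5 : Runs dblLoop (file [] (false :: true :: r) [] [] [] [] [] out.reverse [] [] [] [] [])
      (file [] ((out.flatMap fun b => [b, b]) ++ false :: true :: r) [] [] [] [] [] [] [] [] [] [] [])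
      (4 * out.length + 1) :=
    (runs_dblLoop out.reverse [] (false :: true :: r) [] [] [] [] [] [] [] [] [] []).of_eq (by simp) (by simp)
  have h6 : Runs (push .out true)
      (file [] ((out.flatMap fun b => [b, b]) ++ false :: true :: r) [] [] [] [] [] [] [] [] [] [] [])
      (file [] (true :: ((out.flatMap fun b => [b, b]) ++ false :: true :: r)) [] [] [] [] [] [] [] [] [] [] []) 1 :=
    Runs.push' (by simp)
  have hbranch := h1.seq (h2.seq (h3.seq (h4.seq (h5.seq h6))))
  have hpop : Runs (pop .S
      (pour .B .out ;; push .out true ;; push .out false ;; pour .S .YA ;; dblLoop ;; push .out true)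
      (clear .S ;; clear .B ;; push .out false ;; push .out false)
      (clear .B ;; push .out false ;; push .out false))
      (file [] [] [] r.reverse (true :: out) [] [] [] [] [] [] [] [])
      (file [] (true :: boolPair out r) [] [] [] [] [] [] [] [] [] [] [])
      (3 * r.length + 1 + (1 + (1 + (3 * out.length + 1 + (4 * out.length + 1 + 1)))) + 2) :=
    Runs.pop_true' _ _ (R := file [] [] [] r.reverse (true :: out) [] [] [] [] [] [] [] []) (w := out)
      rfl (by simp) (hbranch.of_eq (by rw [boolPair_eq_flatMap]) le_rfl)
  refine (runs_dispatch_prefix (true :: out) r hpop).of_eq rfl ?_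
  simp only [length_boolPair, List.length_cons]
  omega

/-- **Semantics of stage 3 on a rejecting flag**: `⟨v, r⟩ ↦ 00` whenever `v` is not of the form
`1 out`, within `30 |input| + 30` steps. [folklore] -/
theorem runs_dispatchProg_other (v r : List Bool) (hv : ∀ out, v ≠ true :: out) :
    Runs dispatchProg (file (boolPair v r) [] [] [] [] [] [] [] [] [] [] [] [])
      (file [] [false, false] [] [] [] [] [] [] [] [] [] [] [])
      (30 * (boolPair v r).length + 30) := by
  have hB : ∀ S : List Bool, Runs (clear .B ;; push .out false ;; push .out false)
      (file [] [] [] r.reverse S [] [] [] [] [] [] [] []) (file [] [false, false] [] [] S [] [] [] [] [] [] [] [])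
      (2 * r.length + 1 + (1 + 1)) := by
    intro S
    have k1 : Runs (clear .B) (file [] [] [] r.reverse S [] [] [] [] [] [] [] [])
        (file [] [] [] [] S [] [] [] [] [] [] [] []) (2 * r.length + 1) :=
      (runs_clear _ _).of_eq (by simp) (by simp)
    have k2 : Runs (push .out false) (file [] [] [] [] S [] [] [] [] [] [] [] [])
        (file [] [false] [] [] S [] [] [] [] [] [] [] []) 1 := Runs.push' (by simp)
    have k3 : Runs (push .out false) (file [] [false] [] [] S [] [] [] [] [] [] [] [])
        (file [] [false, false] [] [] S [] [] [] [] [] [] [] []) 1 := Runs.push' (by simp)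
    exact k1.seq (k2.seq k3)
  rcases v with _ | ⟨b, out⟩
  · have hpop : Runs (pop .S
        (pour .B .out ;; push .out true ;; push .out false ;; pour .S .YA ;; dblLoop ;; push .out true)
        (clear .S ;; clear .B ;; push .out false ;; push .out false)
        (clear .B ;; push .out false ;; push .out false))
        (file [] [] [] r.reverse [] [] [] [] [] [] [] [] [])
        (file [] [false, false] [] [] [] [] [] [] [] [] [] [] []) (2 * r.length + 1 + (1 + 1) + 2) :=
      Runs.pop_nil _ _ rfl (hB [])
    refine (runs_dispatch_prefix [] r hpop).of_eq rfl ?_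
    simp only [length_boolPair, List.length_nil]
    omega
  · cases b
    · have hS : Runs (clear .S) (file [] [] [] r.reverse out [] [] [] [] [] [] [] [])
          (file [] [] [] r.reverse [] [] [] [] [] [] [] [] []) (2 * out.length + 1) :=
        (runs_clear _ _).of_eq (by simp) (by simp)
      have hpop : Runs (pop .S
          (pour .B .out ;; push .out true ;; push .out false ;; pour .S .YA ;; dblLoop ;; push .out true)
          (clear .S ;; clear .B ;; push .out false ;; push .out false)
          (clear .B ;; push .out false ;; push .out false))
          (file [] [] [] r.reverse (false :: out) [] [] [] [] [] [] [] [])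
          (file [] [false, false] [] [] [] [] [] [] [] [] [] [] [])
          (2 * out.length + 1 + (2 * r.length + 1 + (1 + 1)) + 2) :=
        Runs.pop_false' _ _ (R := file [] [] [] r.reverse (false :: out) [] [] [] [] [] [] [] []) (w := out)
          rfl (by simp) (hS.seq (hB []))
      refine (runs_dispatch_prefix (false :: out) r hpop).of_eq rfl ?_
      simp only [length_boolPair, List.length_cons]
      omega
    · exact absurd rfl (hv out)

/-- **Stage 3 as a `TM2` machine**: `⟨1 out, r⟩ ↦ 1 ⟨out, r⟩` and `⟨v, r⟩ ↦ 00` for every other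
`v`, within `31 |input| + 31` steps (the form `OkDispatchMachine P 31` of
`Williams2014MachineB.lean`). [cite: AroraBarak2009, §1.3 (machine constructions)] -/
theorem exists_okDispatchMachine :
    ∃ P : TM2ComputableAux Bool Bool,
      (∀ out r : List Bool, P.OutputsWithin (boolPair (true :: out) r) (true :: boolPair out r)
        (31 * (boolPair (true :: out) r).length + 31)) ∧
      (∀ v r : List Bool, (∀ out, v ≠ true :: out) →
        P.OutputsWithin (boolPair v r) [false, false] (31 * (boolPair v r).length + 31)) := by
  refine ⟨(compile (dispatchProg.map (Fintype.equivFin PR))).toAux (Fintype.equivFin PR .inp)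
    (Fintype.equivFin PR .out), fun out r => ?_, fun v r hv => ?_⟩
  · have h := runs_dispatchProg_true out r
    rw [← init_inp_eq_file, ← init_out_eq_file] at h
    exact (Com.outputsWithin_of_runs_equiv (Fintype.equivFin PR) (Or.inl h)).mono (by omega)
  · have h := runs_dispatchProg_other v r hv
    rw [← init_inp_eq_file, ← init_out_eq_file] at h
    exact (Com.outputsWithin_of_runs_equiv (Fintype.equivFin PR) (Or.inl h)).mono (by omega)

end MachineB

end Literature.Computability.Complexity
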